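import Summits.BirchSwinnertonDyer.BirchSwinnertonDyer.Theorems.PrintCf2RubinValueTwoTwistedKummerEulerStep
import Literature.NumberTheory.ComplexMultiplication.EllipticUnits.KatoLayerArtinExponents
import HarnessLib

/-!
# Every non-zero ideal lattice `ι(𝔪) ⊂ ℂ` is a period lattice, as soon as ONE of them is — the input `hLat₀` of (β5-1)

Cell `bsd-print-cf2`, WIDTH seat `bsd-line-cf2-p1-w5` g11 (prover-bsd-line-cf2-p1-w5-g11-0); discharge of the displayed input `hLat₀` «for every
`𝔪 ≠ 0` there is a period pair with lattice `ι(𝔪)`» of step (β5-1) (`TwistedZeta.hG1_of_canonical`) of the (LZ) blueprint behind hZC (ROW 2 of the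
JLK road) on the DECIDING child stmt-BirchSwinnertonDyer-24721; `--supports` 24721 (helper, Theses-free). THEOREMS ONLY (no definition, no named
fact, no instance, no `sorry`). HONEST FRAMING: lattice bookkeeping (Mathlib `ZLattice` through the tree's `PeriodPair.exists_lattice_eq_of_le` and
-w2 g17's `KatoThetaNorm.exists_periodPair_mem_iff_of_le`); nothing here closes the crux; no summit statement is proved by this seat; BSD is not
proved by any of this.

* `exists_periodPair_mem_iff_top` — from a period pair of lattice `ι(𝔤)` (`𝔤 ≠ 0`) UP to one of lattice `ι(𝒪_K)`;
* `forall_exists_periodPair_mem_iff` — hence DOWN to every `ι(𝔪)`, `𝔪 ≠ 0` (= `hLat₀`);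
* `hLat₀_of_isKatoUnitRep`, **`hLat₀_of_twistedIwasawaData`** — the source: any Kato representative (`IsKatoUnitRep` carries the period pair
  `ι(p^s𝔣)`), in particular pin (Z1) of any twisted Iwasawa datum `D` at any admissible `𝔞`.

References: E. de Shalit (1987) II.2.3 (10); K. Kato, Astérisque 295 (2004) §15.5 (15.3.1); J. H. Silverman (1994) Ch. II §1.1.
-/

noncomputable section

open scoped Classical

-- the summit namespace `Summit.BirchSwinnertonDyer.BirchSwinnertonDyer` repeats the problem name by design (D-0017)
set_option linter.dupNamespace false
set_option autoImplicit false

open scoped NumberField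
open Field IsDedekindDomain
open Literature.NumberTheory.EllipticCurves
open Literature.NumberTheory.ComplexMultiplication.EllipticUnits
open Literature.NumberTheory.ComplexMultiplication.EllipticUnits.JohnsonLeungKings2011
open Summit.BirchSwinnertonDyer.BirchSwinnertonDyer.Theorems.PrintCf2

namespace Summit.BirchSwinnertonDyer.BirchSwinnertonDyer.Theorems.PrintCf2.TwistedZeta

variable {K : Type} [Field K] [NumberField K] (ι : K →+* ℂ)

omit [NumberField K] in
/-- **UP to `ι(𝒪_K)`**: a period pair of lattice `ι(𝔤)`, `𝔤 ≠ 0`, gives one of lattice `ι(𝒪_K) ⊇ ι(𝔤)` (`ι(g)·ι(𝒪_K) ⊆ ι(𝔤)` for `0 ≠ g ∈ 𝔤`;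
`PeriodPair.exists_lattice_eq_of_le`). [cite: deShalit1987, II.2.3 (10)] [cite: Silverman1994, Ch. II §1.1 Cor. 1.5] -/
theorem exists_periodPair_mem_iff_top {L : PeriodPair} {𝔤 : Ideal (𝓞 K)} (hL : ∀ z : ℂ, z ∈ L.lattice ↔ ∃ a ∈ 𝔤, z = ι (a : K))
    (h𝔤 : 𝔤 ≠ ⊥) : ∃ P : PeriodPair, ∀ z : ℂ, z ∈ P.lattice ↔ ∃ a ∈ (⊤ : Ideal (𝓞 K)), z = ι (a : K) := by
  -- the target lattice `ι(𝒪_K)` as a `ℤ`-submodule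
  let f : 𝓞 K →+ ℂ := ι.toAddMonoidHom.comp (algebraMap (𝓞 K) K).toAddMonoidHom
  let Λ' : Submodule ℤ ℂ := ((⊤ : Ideal (𝓞 K)).toAddSubgroup.map f).toIntSubmodule
  have hΛ' : ∀ z : ℂ, z ∈ Λ' ↔ ∃ a ∈ (⊤ : Ideal (𝓞 K)), z = ι (a : K) := by
    intro z
    change z ∈ (⊤ : Ideal (𝓞 K)).toAddSubgroup.map f ↔ _
    rw [AddSubgroup.mem_map]
    constructor
    · rintro ⟨a, ha, rfl⟩
      exact ⟨a, ha, rfl⟩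
    · rintro ⟨a, ha, rfl⟩
      exact ⟨a, ha, rfl⟩
  obtain ⟨g, hg, hg0⟩ := Submodule.exists_mem_ne_zero_of_ne_bot h𝔤
  have hc0 : ι (g : K) ≠ 0 := (map_ne_zero ι).mpr (NumberField.RingOfIntegers.coe_ne_zero_iff.mpr hg0)
  have hle : L.lattice ≤ Λ' := by
    intro x hx
    obtain ⟨a, -, rfl⟩ := (hL x).mp hx
    exact (hΛ' _).mpr ⟨a, Submodule.mem_top, rfl⟩
  have hmul : ∀ z ∈ Λ', ι (g : K) * z ∈ L.lattice := by
    intro z hz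
    obtain ⟨a, -, rfl⟩ := (hΛ' z).mp hz
    rw [hL]
    refine ⟨g * a, 𝔤.mul_mem_right a hg, ?_⟩
    push_cast
    rw [map_mul]
  obtain ⟨P, hP⟩ := L.exists_lattice_eq_of_le hle hc0 hmul
  exact ⟨P, fun z ↦ by rw [hP]; exact hΛ' z⟩

omit [NumberField K] in
/-- **ALL non-zero ideal lattices are period lattices, given one**: from a period pair of lattice `ι(𝔤)` (`𝔤 ≠ 0`), for every `𝔪 ≠ 0` a period pair of
lattice `ι(𝔪)` (up to `ι(𝒪_K)`, then down by -w2 g17's `exists_periodPair_mem_iff_of_le` with `0 ≠ c ∈ 𝔪`). [cite: deShalit1987, II.2.3 (10)] [cite: Silverman1994, Ch. II §1.1 Cor. 1.5] -/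
theorem forall_exists_periodPair_mem_iff {L : PeriodPair} {𝔤 : Ideal (𝓞 K)} (hL : ∀ z : ℂ, z ∈ L.lattice ↔ ∃ a ∈ 𝔤, z = ι (a : K))
    (h𝔤 : 𝔤 ≠ ⊥) (𝔪 : Ideal (𝓞 K)) (h𝔪 : 𝔪 ≠ ⊥) : ∃ P : PeriodPair, ∀ z : ℂ, z ∈ P.lattice ↔ ∃ a ∈ 𝔪, z = ι (a : K) := by
  obtain ⟨P₀, hP₀⟩ := exists_periodPair_mem_iff_top ι hL h𝔤
  obtain ⟨c, hc, hc0⟩ := Submodule.exists_mem_ne_zero_of_ne_bot h𝔪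
  exact KatoThetaNorm.exists_periodPair_mem_iff_of_le hP₀ le_top hc0 fun a _ ↦ 𝔪.mul_mem_right a hc

variable (p : ℕ) [Fact p.Prime] (𝔣 : Ideal (𝓞 K))

/-- **`hLat₀` from any Kato representative** (`IsKatoUnitRep` carries a period pair of lattice `ι(p^s𝔣)`; `𝔣 ≠ 0`).
[cite: Kato2004Asterisque, §15.5 (p. 253) and (15.3.1) (p. 252)] [cite: deShalit1987, II.2.3 (10)] -/
theorem hLat₀_of_isKatoUnitRep (h𝔣 : 𝔣 ≠ ⊥) {s : ℕ} {𝔞 : Ideal (𝓞 K)} {u : (AlgebraicClosure K)ˣ} (hu : IsKatoUnitRep p ι 𝔣 s 𝔞 u)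
    (𝔪 : Ideal (𝓞 K)) (h𝔪 : 𝔪 ≠ ⊥) : ∃ P : PeriodPair, ∀ z : ℂ, z ∈ P.lattice ↔ ∃ a ∈ 𝔪, z = ι (a : K) := by
  obtain ⟨-, L, La, S, hL, -, -, -⟩ := hu
  exact forall_exists_periodPair_mem_iff ι hL (katoModulus_ne_bot p 𝔣 h𝔣 s) 𝔪 h𝔪

variable {κ₁ κ₂ : ZpExtension K p} {γ₁ γ₂ : absoluteGaloisGroup K} {θ : absoluteGaloisGroup K →ₜ* ℤ_[p]ˣ}

/-- **`hLat₀` from a twisted Iwasawa datum**: pin (Z1) of `D` at any admissible `𝔞` (and a Kato level `s` with `Gal(K̄/K(p^s𝔣)) ≤ Gal(K̄/K̃_0)`) yields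
a Kato representative, hence every ideal lattice `ι(𝔪)`, `𝔪 ≠ 0`, is a period lattice (`K` totally complex, `𝔣 ≠ 0`).
[cite: JohnsonLeungKings2011, Def. 3.2 and §5.2 (arXiv p0009:L55–70, p0014:L80–90)] [cite: Kato2004Asterisque, §15.5 (p. 253)] -/
theorem hLat₀_of_twistedIwasawaData [NumberField.IsTotallyComplex K] (h𝔣 : 𝔣 ≠ ⊥) (D : TwistedIwasawaData p κ₁ κ₂ γ₁ γ₂ θ 𝔣 ι)
    (a : AuxIdeals p 𝔣) (𝔪 : Ideal (𝓞 K)) (h𝔪 : 𝔪 ≠ ⊥) : ∃ P : PeriodPair, ∀ z : ℂ, z ∈ P.lattice ↔ ∃ a ∈ 𝔪, z = ι (a : K) := by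
  obtain ⟨s₀, hs₀⟩ := D.aZeta_proj a 0 0
  obtain ⟨s₁, hs₁⟩ := JohnsonLeungKings2011.exists_katoLevelSubgroup_le_pairLayerSubgroup (p := p) 𝔣 h𝔣 κ₁ κ₂ 0
  have hle : katoLevelSubgroup p 𝔣 (s₀ + s₁) ≤ JohnsonLeungKings2011.pairLayerSubgroup κ₁ κ₂ 0 :=
    (katoLevelSubgroup_antitone p 𝔣 h𝔣 (Nat.le_add_left s₁ s₀)).trans hs₁
  obtain ⟨u, -, -, hu, -⟩ := hs₀ (s₀ + s₁) (Nat.le_add_right s₀ s₁) hle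
  exact hLat₀_of_isKatoUnitRep ι p 𝔣 h𝔣 hu 𝔪 h𝔪

end Summit.BirchSwinnertonDyer.BirchSwinnertonDyer.Theorems.PrintCf2.TwistedZeta

end
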